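import Summits.AnomalousDissipation.AnomalousDissipation.Theorems.SolenoidalFractalHomogenisationLagrangianStepVmodDistortedTestPairingBase
import Summits.AnomalousDissipation.AnomalousDissipation.Theorems.SolenoidalFractalHomogenisationLagrangianStepVmodDistortedCorrectedTest
import Summits.AnomalousDissipation.AnomalousDissipation.Theorems.SolenoidalFractalHomogenisationLagrangianStepVmodFrameDefsJ
import HarnessLib

/-!
# K1L_D (stmt-AnomalousDissipation-27980), (ℓ3-A) road A: (D-GEN-J) from a GENERAL BASE TIME — the distorted propagator against the co-moving
# corrected steady test `J(t)•ζ₀` from the base `s`: `|⟪U s t y, J(t)•ζ₀⟫ − ⟪y, J(s)•ζ₀⟫| ≤ (t−s)·N·‖y‖`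
(helper; `--supports 27980 --as helper`; prover ad-k1loc-p3 g12; port of p724081 `…_of_correctedTest` to a general base time on top of the base-`s`
(D-GEN) `…_frameClass_base`; the last mechanical piece of the PIN TRICK chain of memo `HOME/ad-k1loc-p3/S2-NOTE-p3g12.md` §2: with the pin transfer
`A_σ = −⟪ζ, T (t₀−σ) t₀ [g_σ]⟫` (p731106) one applies THIS bound to the COARSE member `T` from the base `s = t₀ − σ` with the datum `[g_σ]`.)

CONVENTION (D28-8′): derivative-index distortion `Torus.Visc4.conj`; constraint `∇·(G v) = 0`.

* **`IsDistortedPropagator.abs_inner_sub_inner_le_of_correctedTest_base`** — explicit `J`-regularity hypotheses (as p724081);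
* **`IsDistortedPropagator.abs_inner_sub_inner_le_of_correctedTest_frameRegular_base`** — the same over the bundled predicate
  `VmodDist.IsFrameRegular θ Tw nC G J` (p725291), whose fields ARE those hypotheses; the size of `N` is p727884's `IsFrameRegular.hN_correctedTest`
  (base-free: a.e. on `(0,Tw)`).
`sorry`-free; NOT a proof of any block, of K1L_D or of AD; rung F-D1.A0.
-/

set_option linter.dupNamespace false

noncomputable section

namespace Summit.AnomalousDissipation.AnomalousDissipation.Theorems.SolenoidalFractalHomogenisation.LagrangianStep.CellClauseMod

open Literature.Analysis Literature.Analysis.FluidPDE Literature.Analysis.FunctionSpaces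
open MeasureTheory Set Filter UnitAddTorus Function Topology
open scoped ENNReal NNReal InnerProductSpace
open Summit.AnomalousDissipation.AnomalousDissipation.Theorems.SolenoidalFractalHomogenisation.LagrangianStep.VmodDist (IsFrameRegular)

variable {Tw : ℝ} {𝔸 : Torus.Visc4 (Fin 3)} {b : ℝ → VF} {G J J' : ℝ → UnitAddTorus (Fin 3) → Matrix (Fin 3) (Fin 3) ℝ}
  {U : ℝ → ℝ → (V2 →L[ℝ] V2)} {ζ₀ : VF}

set_option maxHeartbeats 800000 in
/-- **(D-GEN-J) FROM A GENERAL BASE TIME.**  For a distorted propagator over a frame modulation, the existence clause `hsol`, a pointwise inverse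
frame `J` (`G J = 1`) with smooth slices, jointly continuous iterated derivatives, time-Lipschitz entries and an a.e. time derivative `J'`, a smooth
flat-solenoidal steady test `ζ₀`, and `N ≥ ‖J'•ζ₀ + (b·∇)(J•ζ₀) + 𝓛^{G,*}_𝔸 (J•ζ₀)‖_{L²}` a.e. on `(0,Tw)`: for `0 ≤ s < Tw`, every `t ∈ [s,Tw]` and
`y ∈ V2`,  `|⟪U s t y, J(t)•ζ₀⟫ − ⟪y, J(s)•ζ₀⟫| ≤ (t − s)·N·‖y‖`.
[cite: DiPernaLions1989, §II.1 (12)–(14)] [cite: Temam1997, Ch. II §3.1–3.2, (3.2)–(3.5), Thm. 3.1] -/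
theorem IsDistortedPropagator.abs_inner_sub_inner_le_of_correctedTest_base {θ nC : ℝ} (hU : IsDistortedPropagator Tw 𝔸 b G U)
    (hG : IsFrameModulation θ Tw nC G)
    (hsol : ∀ s, 0 ≤ s → s < Tw → ∀ (φ : VF) (hφ : MemLp φ 2 volume), Torus.IsWeaklyDivFree (Torus.distort (G s) φ) → ∃ w : ℝ → VF,
      Torus.IsWeakTensorPassiveVectorDistortedOn 0 (Tw - s) 𝔸 (fun τ => b (s + τ)) (fun τ => G (s + τ)) φ w)
    (hGJ : ∀ t y, G t y * J t y = 1)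
    (hJs : ∀ t a c, Torus.IsSmooth (fun y => J t y a c))
    (hJc : ∀ (l : List (Fin 3)) (a c : Fin 3), Continuous (uncurry fun t y => Torus.iterPartialDeriv l (fun y => J t y a c) y))
    (hJL : ∃ K : ℝ, ∀ t ∈ Icc 0 Tw, ∀ s ∈ Icc 0 Tw, ∀ y a c, |J t y a c - J s y a c| ≤ K * |t - s|)
    (hJ' : ∀ᵐ t ∂(volume.restrict (Ioo 0 Tw)), ∀ y, HasDerivAt (fun s => J s y) (J' t y) t)
    (hζs : Torus.IsSmooth ζ₀) (hζdiv : Torus.IsDivFree ζ₀)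
    {N : ℝ} (hN0 : 0 ≤ N)
    (hN : ∀ᵐ τ ∂(volume.restrict (Ioo 0 Tw)),
      MemLp (fun x => Torus.distort (J' τ) ζ₀ x + Torus.convect (b τ) (Torus.distort (J τ) ζ₀) x +
          Torus.viscAdjVar (fun y => Torus.Visc4.conj (G τ y) 𝔸) (Torus.distort (J τ) ζ₀) x) 2 volume ∧
      eLpNorm (fun x => Torus.distort (J' τ) ζ₀ x + Torus.convect (b τ) (Torus.distort (J τ) ζ₀) x +
          Torus.viscAdjVar (fun y => Torus.Visc4.conj (G τ y) 𝔸) (Torus.distort (J τ) ζ₀) x) 2 volume ≤ ENNReal.ofReal N)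
    {s : ℝ} (hs : 0 ≤ s) (hsT : s < Tw) {t : ℝ} (ht : t ∈ Icc s Tw) (y : V2) :
    |⟪U s t y, ((Torus.isSmooth_distort (hJs t) hζs).memLp 2).toLp (Torus.distort (J t) ζ₀)⟫_ℝ
        - ⟪y, ((Torus.isSmooth_distort (hJs s) hζs).memLp 2).toLp (Torus.distort (J s) ζ₀)⟫_ℝ| ≤ (t - s) * N * ‖y‖ := by
  set ψ : ℝ → VF := fun t => Torus.distort (J t) ζ₀ with hψdef
  have hψs : ∀ t, Torus.IsSmooth (ψ t) := fun t => Torus.isSmooth_distort (hJs t) hζs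
  have hζc : ∀ l : List (Fin 3), Continuous (uncurry fun (_ : ℝ) y => Torus.iterPartialDeriv l ζ₀ y) :=
    fun l => (hζs.iterPartialDeriv l).continuous.comp continuous_snd
  have hψc : ∀ l : List (Fin 3), Continuous (uncurry fun t y => Torus.iterPartialDeriv l (ψ t) y) :=
    fun l => Torus.continuous_uncurry_iterPartialDeriv_distort (J := J) (φ := fun _ => ζ₀) hJs (fun _ => hζs) hJc hζc l
  have hψL : ∃ L : ℝ, 0 ≤ L ∧ ∀ t ∈ Icc 0 Tw, ∀ s ∈ Icc 0 Tw, ∀ y, ‖ψ t y - ψ s y‖ ≤ L * |t - s| :=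
    correctedTest_lipschitz hζs hJc hJL
  have hψdiv : ∀ t, Torus.IsDivFree (Torus.distort (G t) (ψ t)) := correctedTest_isDivFree hGJ hζdiv
  have hψ' : ∀ᵐ t ∂(volume.restrict (Ioo 0 Tw)), ∀ y, HasDerivAt (fun s => ψ s y) (Torus.distort (J' t) ζ₀ y) t := by
    filter_upwards [hJ'] with t ht' y
    exact correctedTest_hasDerivAt ht' y
  exact hU.abs_inner_sub_inner_le_of_lipschitzTest_frameClass_base hG hsol (ψ' := fun t y => Torus.distort (J' t) ζ₀ y)
    hψs hψc hψL hψdiv hψ' hN0 hN hs hsT ht y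

/-- **(D-GEN-J) from a general base time OVER `IsFrameRegular`** (the bundled `J`-regularity of the v3 texts): the a.e. derivative `J'` is the one
the predicate provides, and `N` is any a.e. bound of the corrected generator along it (e.g. p727884's `IsFrameRegular.hN_correctedTest`). -/
theorem IsDistortedPropagator.abs_inner_sub_inner_le_of_correctedTest_frameRegular_base {θ nC : ℝ} (hU : IsDistortedPropagator Tw 𝔸 b G U)
    (hG : IsFrameModulation θ Tw nC G) (hR : IsFrameRegular θ Tw nC G J)
    (hsol : ∀ s, 0 ≤ s → s < Tw → ∀ (φ : VF) (hφ : MemLp φ 2 volume), Torus.IsWeaklyDivFree (Torus.distort (G s) φ) → ∃ w : ℝ → VF,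
      Torus.IsWeakTensorPassiveVectorDistortedOn 0 (Tw - s) 𝔸 (fun τ => b (s + τ)) (fun τ => G (s + τ)) φ w)
    (hζs : Torus.IsSmooth ζ₀) (hζdiv : Torus.IsDivFree ζ₀)
    (hJ' : ∀ᵐ t ∂(volume.restrict (Ioo 0 Tw)), ∀ y, HasDerivAt (fun s => J s y) (J' t y) t)
    {N : ℝ} (hN0 : 0 ≤ N)
    (hN : ∀ᵐ τ ∂(volume.restrict (Ioo 0 Tw)),
      MemLp (fun x => Torus.distort (J' τ) ζ₀ x + Torus.convect (b τ) (Torus.distort (J τ) ζ₀) x +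
          Torus.viscAdjVar (fun y => Torus.Visc4.conj (G τ y) 𝔸) (Torus.distort (J τ) ζ₀) x) 2 volume ∧
      eLpNorm (fun x => Torus.distort (J' τ) ζ₀ x + Torus.convect (b τ) (Torus.distort (J τ) ζ₀) x +
          Torus.viscAdjVar (fun y => Torus.Visc4.conj (G τ y) 𝔸) (Torus.distort (J τ) ζ₀) x) 2 volume ≤ ENNReal.ofReal N)
    {s : ℝ} (hs : 0 ≤ s) (hsT : s < Tw) {t : ℝ} (ht : t ∈ Icc s Tw) (y : V2) :
    |⟪U s t y, ((Torus.isSmooth_distort (hR.smooth t) hζs).memLp 2).toLp (Torus.distort (J t) ζ₀)⟫_ℝ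
        - ⟪y, ((Torus.isSmooth_distort (hR.smooth s) hζs).memLp 2).toLp (Torus.distort (J s) ζ₀)⟫_ℝ| ≤ (t - s) * N * ‖y‖ :=
  hU.abs_inner_sub_inner_le_of_correctedTest_base hG hsol hR.mul_eq_one hR.smooth (fun l a c => hR.jointCont a c l) hR.lipschitz hJ'
    hζs hζdiv hN0 hN hs hsT ht y

end Summit.AnomalousDissipation.AnomalousDissipation.Theorems.SolenoidalFractalHomogenisation.LagrangianStep.CellClauseMod

end
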